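import Literature.Analysis.UnboundedOperators.LinearizedBoltzmannQuarticWeightAction
import Summits.AtomisticToContinuum.HydrodynamicLimit.Theorems.TwoClocksEquilibriumFastWindowLDBirthT12Thales
import HarnessLib

/-!
# The hard-sphere gain operator on the log-quadratic weight `Φ = (1 + |v|²)(1 + log (1 + |v|²))`, with
# its `1/log` margin (helpers `t12_lintegral_gain_fst_logWeight_le`, `t12_gain_logWeight_margin` of the
# line `birth`, crux `TwoClocks.EquilibriumFastWindowLD`, stmt-AtomisticToContinuum-14440; infrastructure
# towards the registered analytic sub-goal `t12_logLinearPreimage_and_dipoleModulus`)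

The `R`-uniform a-priori bound of the orthogonal Chapman–Enskog pre-image `ψ₀ = L⁻¹ g` of QUADRATIC data
`|g| ≤ C_g (1 + |v|²)` (`…BirthQuarticPreimage`, `|ψ₀| ≤ C C_g (1 + |v|²)²`) is one power off the truth
(`|v|² log |v|`, plan `t12_corrector_analysis.md` §3). The weighted sup-norm scheme of Grad (1963) /
Caflisch (1980) / Guo (2010), in the form of the tree's quartic scheme
(`Literature.Analysis.UnboundedOperators.LinearizedBoltzmannQuarticWeightAction` /
`…QuarticAbsorption` / `…PolynomialInverse`), needs a weight `W` with `ν⁻¹ K₂ W ≤ θ W`, `θ < 1`, at large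
speed; radial powers `(1 + |v|²)^{α/2}` have `ν⁻¹ K₂ W / W → λ₀(α) = 4/(α + 2)`, so `α = 2` is exactly
critical. This file proves that the log-corrected critical weight
`Φ(v) := P (1 + log P)`, `P := 1 + |v|²`, IS a strict supersolution, with a margin of relative size
`≍ 1/log P` coming from the flux-law DISTRIBUTION of the energy split:

* `hardSphereKernel_mul_logWeight_collide_le` — collision algebra: with `X := P - ⟪v, ω⟫²` (so that
  `1 + |v'|² = X + ⟪v_*, ω⟫²`, `norm_sq_collide_fst_eq`) and `h(x) := x (1 + log x)`,
  `((v - v_*)·ω)₊ h(1 + |v'|²) ≤ (v·ω)₊ h(X) + Φ(v) (1 + |v_*|)⁵` (`log (X + c²) ≤ log X + c²/X`);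
* `lintegral_posPart_mul_logWeight_eq` — the EXACT flux integral of the frozen-partner piece:
  `∫_{S²} (v·ω)₊ h(P - ⟪v, ω⟫²) dσ = (π/|v|) (P²/4 + (P²/2) log P - 1/4)` — under the flux law
  `⟪v, ω⟫²/|v|²` is uniform on `[0, 1]` (`lintegral_hardSphereKernel_mul_comp_cosSq` of `…T12Thales`), and
  `∫₀¹ h(P - |v|² t) dt = |v|⁻² ∫₁^P h = |v|⁻² [x²/4 + (x²/2) log x]₁^P`;
* **`t12_lintegral_gain_fst_logWeight_le`** (registered helper) — the first gain integral of `Φ`: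
  `∫∫ ((v - v_*)·ω)₊ M(v_*) Φ(v') dω dv_* ≤ (π/|v|)(P²/4 + (P²/2) log P - 1/4) + σ(S²) m₅ Φ(v)`,
  `m₅ = ∫ (1 + |w|)⁵ dM`, for `v ≠ 0`;
* **`t12_gain_logWeight_margin`** (registered helper) — the margin: with the sharp `ν(v) ≥ π|v|`
  (`pi_mul_norm_le_collisionFrequency`), twice the bound above (own + partner pieces, `K₂'' = K₂'`) is
  `≤ ν(v) (Φ(v) - P/4)` as soon as `(1 + log P)(1/|v|² + 2 σ(S²) m₅/(π |v|)) ≤ 1/4` — i.e.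
  **`ν⁻¹ K₂ Φ ≤ Φ - P/4`** in the far field: the leading term is
  `(P/|v|²)(Φ - P/2) = Φ - P/2 + O(Φ/|v|²)` (`2 ∫₀¹ h(xP) dx = h(P) - P/2`), an ABSOLUTE margin `P/4`
  of relative size `1/(4 (1 + log P)) → 0`, which still dominates the data term `C_g P/ν ≍ C_g |v|`, the
  partner-loss term `K₁ ψ = O((1 + |v|) ‖ψ‖_{L²(M)})` and the `w`-corrections `O(Φ/|v|)`.

The absorption under the truncated weight `Φ + (1 + |v|²)²/N` (margin `min (P/4, ·)` uniform on
`{Φ ≥ P²/N}` for each `N`, constants uniform in `N`) and the resulting bound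
`|ψ₀(v)| ≤ C C_g (1 + |v|²)(1 + log (1 + |v|²))` are in the sibling file `…BirthT12LogQuadraticB`.
References for the scheme: Grad 1963 §4; Caflisch, CMP 74 (1980) §2; Guo, ARMA 197 (2010) §3;
Cercignani–Illner–Pulvirenti 1994 §7.2 (operator), §3.1 (collision rule). All statements here are
elementary consequences of the collision rule and the flux law, tagged folklore.
-/

noncomputable section

open MeasureTheory ProbabilityTheory Real Set Filter Metric
open scoped ENNReal BigOperators InnerProductSpace

namespace Summit.AtomisticToContinuum.HydrodynamicLimit.Theorems.ClampedCorrectorBirth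

open Literature.Analysis.FluidPDE Literature.MathematicalPhysics.KineticTheory
open Literature.Analysis.UnboundedOperators

/-! ### Collision algebra of the log-quadratic weight -/

/-- The scalar log inequality behind the log-quadratic weight: for `1 ≤ X` and `0 ≤ s`,
`(X + s)(1 + log (X + s)) ≤ X (1 + log X) + s (2 + log X) + s²`
(`log (X + s) ≤ log X + s/X`). [folklore] -/
theorem logWeight_add_le {X s : ℝ} (hX : 1 ≤ X) (hs : 0 ≤ s) :
    (X + s) * (1 + Real.log (X + s)) ≤ X * (1 + Real.log X) + s * (2 + Real.log X) + s ^ 2 := by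
  have hX0 : 0 < X := by linarith
  have hXs : 0 < X + s := by linarith
  have hlog : Real.log (X + s) ≤ Real.log X + s / X := by
    have h := Real.log_le_sub_one_of_pos (div_pos hXs hX0)
    rw [Real.log_div hXs.ne' hX0.ne'] at h
    have : (X + s) / X - 1 = s / X := by field_simp; ring
    linarith
  have h1 : (X + s) * (1 + Real.log (X + s)) ≤ (X + s) * (1 + Real.log X + s / X) :=
    mul_le_mul_of_nonneg_left (by linarith) hXs.le
  have h2 : (X + s) * (1 + Real.log X + s / X) = X * (1 + Real.log X) + s * (2 + Real.log X) + s ^ 2 / X := by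
    field_simp; ring
  have h3 : s ^ 2 / X ≤ s ^ 2 := div_le_self (sq_nonneg _) hX
  linarith

/-- Algebra of the log-quadratic weight `Φ = (1 + |·|²)(1 + log (1 + |·|²))` after a collision: with
`X = 1 + |v|² - ⟪v, ω⟫²` (so that `1 + |v'|² = X + ⟪v_*, ω⟫²`),
`((v - v_*)·ω)₊ Φ(v') ≤ (v·ω)₊ X (1 + log X) + Φ(v) (1 + |v_*|)⁵`. [folklore] -/
theorem hardSphereKernel_mul_logWeight_collide_le (ω : sphere (0 : EuclideanSpace ℝ (Fin 3)) 1)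
    (v w : EuclideanSpace ℝ (Fin 3)) :
    hardSphereKernel (v, w) ω * ((1 + ‖(collide ω (v, w)).1‖ ^ 2) *
        (1 + Real.log (1 + ‖(collide ω (v, w)).1‖ ^ 2))) ≤
      hardSphereKernel (v, 0) ω * ((1 + ‖v‖ ^ 2 - ⟪v, (ω : EuclideanSpace ℝ (Fin 3))⟫_ℝ ^ 2) *
          (1 + Real.log (1 + ‖v‖ ^ 2 - ⟪v, (ω : EuclideanSpace ℝ (Fin 3))⟫_ℝ ^ 2))) +
        (1 + ‖v‖ ^ 2) * (1 + Real.log (1 + ‖v‖ ^ 2)) * (1 + ‖w‖) ^ 5 := by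
  set a : ℝ := ⟪v, (ω : EuclideanSpace ℝ (Fin 3))⟫_ℝ with ha
  set c : ℝ := ⟪w, (ω : EuclideanSpace ℝ (Fin 3))⟫_ℝ with hc
  set P : ℝ := 1 + ‖v‖ ^ 2 with hP
  set t : ℝ := ‖w‖ with ht
  set X : ℝ := 1 + ‖v‖ ^ 2 - a ^ 2 with hX
  set B : ℝ := hardSphereKernel (v, w) ω
  set B₀ : ℝ := hardSphereKernel (v, 0) ω with hB₀
  set L : ℝ := 1 + Real.log P with hL
  have ht0 : 0 ≤ t := norm_nonneg _
  have hP1 : 1 ≤ P := by rw [hP]; nlinarith [norm_nonneg v]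
  have ha2 : a ^ 2 ≤ ‖v‖ ^ 2 := by
    rw [← sq_abs]; exact pow_le_pow_left₀ (abs_nonneg _) (abs_inner_sphere_le v ω) 2
  have hc2 : c ^ 2 ≤ t ^ 2 := by
    rw [← sq_abs, ht]; exact pow_le_pow_left₀ (abs_nonneg _) (abs_inner_sphere_le w ω) 2
  have hX1 : 1 ≤ X := by rw [hX]; linarith
  have hXP : X ≤ P := by rw [hX, hP]; nlinarith
  have hB₀0 : 0 ≤ B₀ := le_max_right _ _
  have hBle : B ≤ B₀ + t := hardSphereKernel_le_posPart_add_norm v w ω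
  have hB₀le : B₀ ≤ P := by
    have h1 : B₀ ≤ ‖v‖ := by
      rw [hB₀]; simp only [hardSphereKernel, sub_zero]
      exact max_le ((le_abs_self _).trans (abs_inner_sphere_le v ω)) (norm_nonneg _)
    rw [hP]; nlinarith [norm_nonneg v]
  have hcol : 1 + ‖(collide ω (v, w)).1‖ ^ 2 = X + c ^ 2 := by
    rw [norm_sq_collide_fst_eq, hX, ha, hc]; ring
  rw [hcol]
  -- logarithms: `0 ≤ log X ≤ log P`, `L ≥ 1`
  have hlX0 : 0 ≤ Real.log X := Real.log_nonneg hX1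
  have hlXP : Real.log X ≤ Real.log P := Real.log_le_log (by linarith) hXP
  have hL1 : 1 ≤ L := by rw [hL]; linarith
  -- `h(X + c²) ≤ h(X) + t² (1 + L) + t⁴`
  have hh : (X + c ^ 2) * (1 + Real.log (X + c ^ 2)) ≤ X * (1 + Real.log X) + t ^ 2 * (1 + L) + t ^ 4 := by
    have h := logWeight_add_le hX1 (sq_nonneg c)
    have e1 : c ^ 2 * (2 + Real.log X) ≤ t ^ 2 * (1 + L) := by
      rw [hL]; exact mul_le_mul hc2 (by linarith) (by linarith) (sq_nonneg _)
    have e2 : (c ^ 2) ^ 2 ≤ t ^ 4 := by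
      rw [show t ^ 4 = (t ^ 2) ^ 2 by ring]; exact pow_le_pow_left₀ (sq_nonneg _) hc2 2
    linarith
  have hhXP : X * (1 + Real.log X) ≤ P * L := by
    rw [hL]; exact mul_le_mul hXP (by linarith) (by linarith) (by linarith)
  -- the remainder `t h(X) + (B₀ + t)(t²(1+L) + t⁴) ≤ P L (1 + t)⁵`
  have hrem : t * (X * (1 + Real.log X)) + (B₀ + t) * (t ^ 2 * (1 + L) + t ^ 4) ≤ P * L * (1 + t) ^ 5 := by
    have hPL : 0 ≤ P * L := mul_nonneg (by linarith) (by linarith)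
    have i1 : t * (X * (1 + Real.log X)) ≤ P * L * t := by rw [mul_comm]; exact mul_le_mul_of_nonneg_right hhXP ht0
    have i2 : (B₀ + t) * (t ^ 2 * (1 + L) + t ^ 4) ≤ (P + t) * (L * (2 * t ^ 2 + t ^ 4)) := by
      refine mul_le_mul (by linarith) ?_ (by positivity) (by positivity)
      have e1 : t ^ 2 * (1 + L) ≤ t ^ 2 * (2 * L) := mul_le_mul_of_nonneg_left (by linarith) (sq_nonneg t)
      have e2 : t ^ 4 ≤ t ^ 4 * L := le_mul_of_one_le_right (pow_nonneg ht0 4) hL1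
      linarith
    have i3 : (P + t) * (L * (2 * t ^ 2 + t ^ 4)) ≤ P * L * (2 * t ^ 2 + t ^ 4 + 2 * t ^ 3 + t ^ 5) := by
      have e : (P + t) * (L * (2 * t ^ 2 + t ^ 4)) = P * L * (2 * t ^ 2 + t ^ 4) + L * (2 * t ^ 3 + t ^ 5) := by ring
      have e' : P * L * (2 * t ^ 2 + t ^ 4 + 2 * t ^ 3 + t ^ 5) =
          P * L * (2 * t ^ 2 + t ^ 4) + P * (L * (2 * t ^ 3 + t ^ 5)) := by ring
      rw [e, e']
      have h0 : 0 ≤ L * (2 * t ^ 3 + t ^ 5) := mul_nonneg (by linarith) (by positivity)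
      linarith [le_mul_of_one_le_left h0 hP1]
    have i4 : t + (2 * t ^ 2 + t ^ 4 + 2 * t ^ 3 + t ^ 5) ≤ (1 + t) ^ 5 := by
      rw [show (1 + t) ^ 5 = 1 + 5 * t + 10 * t ^ 2 + 10 * t ^ 3 + 5 * t ^ 4 + t ^ 5 by ring]
      linarith [pow_nonneg ht0 2, pow_nonneg ht0 3, pow_nonneg ht0 4]
    have i5 : P * L * t + P * L * (2 * t ^ 2 + t ^ 4 + 2 * t ^ 3 + t ^ 5) ≤ P * L * (1 + t) ^ 5 := by
      rw [← mul_add]; exact mul_le_mul_of_nonneg_left i4 hPL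
    linarith
  calc B * ((X + c ^ 2) * (1 + Real.log (X + c ^ 2)))
      ≤ (B₀ + t) * (X * (1 + Real.log X) + t ^ 2 * (1 + L) + t ^ 4) := by
        refine mul_le_mul hBle hh ?_ (add_nonneg hB₀0 ht0)
        have : 1 ≤ X + c ^ 2 := by nlinarith [sq_nonneg c]
        exact mul_nonneg (by linarith) (by linarith [Real.log_nonneg this])
    _ = B₀ * (X * (1 + Real.log X)) + (t * (X * (1 + Real.log X)) + (B₀ + t) * (t ^ 2 * (1 + L) + t ^ 4)) := by ring
    _ ≤ B₀ * (X * (1 + Real.log X)) + P * L * (1 + t) ^ 5 := add_le_add le_rfl hrem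

/-! ### The frozen-partner flux integral -/

/-- The primitive of `h(x) = x (1 + log x)`: `H(x) = x²/4 + (x²/2) log x` on `(0, ∞)`. [folklore] -/
theorem hasDerivAt_logWeight_primitive {x : ℝ} (hx : 0 < x) :
    HasDerivAt (fun x => x ^ 2 / 4 + x ^ 2 / 2 * Real.log x) (x * (1 + Real.log x)) x := by
  have h := (((hasDerivAt_pow 2 x).div_const 4).add
    (((hasDerivAt_pow 2 x).div_const 2).mul (Real.hasDerivAt_log hx.ne')))
  refine h.congr_deriv ?_
  have hx0 : x ≠ 0 := hx.ne'
  field_simp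
  ring

/-- `∫₁^P x (1 + log x) dx = P²/4 + (P²/2) log P - 1/4` for `1 ≤ P`. [folklore] -/
theorem integral_logWeight_eq {P : ℝ} (hP : 1 ≤ P) :
    ∫ x in (1:ℝ)..P, x * (1 + Real.log x) = P ^ 2 / 4 + P ^ 2 / 2 * Real.log P - 1 / 4 := by
  have h := intervalIntegral.integral_eq_sub_of_hasDerivAt (a := 1) (b := P)
    (f := fun x => x ^ 2 / 4 + x ^ 2 / 2 * Real.log x) (f' := fun x => x * (1 + Real.log x))
    (fun x hx => hasDerivAt_logWeight_primitive (by rw [Set.uIcc_of_le hP] at hx; linarith [hx.1]))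
    ((ContinuousOn.mul continuousOn_id (continuousOn_const.add (Real.continuousOn_log.mono (by
      intro x hx; rw [Set.uIcc_of_le hP] at hx; simp; linarith [hx.1])))).intervalIntegrable)
  rw [h]; simp

/-- **The flux integral of the log-quadratic weight along the own Thales sphere (partner at rest).**
For `v ≠ 0`, `P = 1 + |v|²`, `h(x) = x (1 + log x)`:
`∫_{S²} (v·ω)₊ h(P - ⟪v, ω⟫²) dσ(ω) = (π/|v|) (P²/4 + (P²/2) log P - 1/4)` — under the flux law
`⟪v, ω⟫²/|v|²` is uniform on `[0, 1]` (`lintegral_hardSphereKernel_mul_comp_cosSq`), and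
`∫₀¹ h(P - |v|² t) dt = |v|⁻² ∫₁^P h`: the exact energy-split average behind the margin `-P/2`. [folklore] -/
theorem lintegral_posPart_mul_logWeight_eq {v : EuclideanSpace ℝ (Fin 3)} (hv : v ≠ 0) :
    ∫⁻ ω, ENNReal.ofReal (hardSphereKernel (v, 0) ω *
        ((1 + ‖v‖ ^ 2 - ⟪v, (ω : EuclideanSpace ℝ (Fin 3))⟫_ℝ ^ 2) *
          (1 + Real.log (1 + ‖v‖ ^ 2 - ⟪v, (ω : EuclideanSpace ℝ (Fin 3))⟫_ℝ ^ 2)))) ∂sphereMeasure =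
      ENNReal.ofReal (Real.pi / ‖v‖ * ((1 + ‖v‖ ^ 2) ^ 2 / 4 +
        (1 + ‖v‖ ^ 2) ^ 2 / 2 * Real.log (1 + ‖v‖ ^ 2) - 1 / 4)) := by
  have hvn : 0 < ‖v‖ := norm_pos_iff.2 hv
  set P : ℝ := 1 + ‖v‖ ^ 2 with hP
  set s : ℝ := ‖v‖ ^ 2 with hs
  have hs0 : 0 < s := by positivity
  have hP1 : 1 ≤ P := by rw [hP]; linarith [hs0.le]
  set h : ℝ → ℝ := fun x => x * (1 + Real.log x) with hh
  set g : ℝ → ℝ≥0∞ := fun t => ENNReal.ofReal (h (P - s * t)) with hg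
  have hgm : Measurable g := by
    refine ENNReal.measurable_ofReal.comp ?_
    have : Measurable h := measurable_id.mul (measurable_const.add Real.measurable_log)
    exact this.comp (measurable_const.sub (measurable_const.mul measurable_id))
  -- the integrand through `c² = ⟪v, ω⟫²/|v|²`
  have hpt : ∀ ω : sphere (0 : EuclideanSpace ℝ (Fin 3)) 1,
      ENNReal.ofReal (hardSphereKernel (v, 0) ω *
        ((P - ⟪v, (ω : EuclideanSpace ℝ (Fin 3))⟫_ℝ ^ 2) *
          (1 + Real.log (P - ⟪v, (ω : EuclideanSpace ℝ (Fin 3))⟫_ℝ ^ 2)))) =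
      ENNReal.ofReal (hardSphereKernel (v, 0) ω) *
        g (⟪v - 0, (ω : EuclideanSpace ℝ (Fin 3))⟫_ℝ ^ 2 / ‖v - 0‖ ^ 2) := by
    intro ω
    have hB0 : 0 ≤ hardSphereKernel (v, 0) ω := le_max_right _ _
    rw [ENNReal.ofReal_mul hB0, sub_zero, ← hs]
    simp only [hg, hh, mul_div_cancel₀ _ hs0.ne']
  simp_rw [hpt]
  rw [lintegral_hardSphereKernel_mul_comp_cosSq hv hgm, sub_zero]
  -- the `t`-integral
  have hcont : ContinuousOn (fun t : ℝ => h (P - s * t)) (Icc 0 1) := by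
    have h1 : ContinuousOn h (Ici 1) := continuousOn_id.mul
      (continuousOn_const.add (Real.continuousOn_log.mono fun x hx => by simp; linarith [mem_Ici.1 hx]))
    exact h1.comp (by fun_prop) fun t ht => by simp only [mem_Ici, hP]; nlinarith [ht.2, hs0]
  have hnn : ∀ t ∈ Icc (0:ℝ) 1, 0 ≤ h (P - s * t) := by
    intro t ht
    have h1 : 1 ≤ P - s * t := by rw [hP]; nlinarith [ht.2, hs0]
    exact mul_nonneg (by linarith) (by linarith [Real.log_nonneg h1])
  have hI : ∫⁻ t in Icc (0:ℝ) 1, g t = ENNReal.ofReal (s⁻¹ * (P ^ 2 / 4 + P ^ 2 / 2 * Real.log P - 1 / 4)) := by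
    rw [hg, ← ofReal_integral_eq_lintegral_ofReal (hcont.integrableOn_Icc)
      ((ae_restrict_iff' measurableSet_Icc).2 (Eventually.of_forall hnn)),
      integral_Icc_eq_integral_Ioc, ← intervalIntegral.integral_of_le zero_le_one,
      intervalIntegral.integral_comp_sub_mul (fun x => h x) hs0.ne', smul_eq_mul]
    rw [show P - s * 1 = 1 by rw [hP, hs]; ring, show P - s * 0 = P by ring, integral_logWeight_eq hP1]
  rw [hI, ← ENNReal.ofReal_mul (by positivity)]
  congr 1
  rw [hs]
  field_simp

/-! ### The gain integral -/

/-- **Registered helper `t12_lintegral_gain_fst_logWeight_le` — the first gain integral of the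
log-quadratic weight `Φ = (1 + |·|²)(1 + log (1 + |·|²))` (`ℝ³`).** For `v ≠ 0`, `P = 1 + |v|²`,
`∫∫ ((v - v_*)·ω)₊ M(v_*) Φ(v') dω dv_* ≤ (π/|v|) (P²/4 + (P²/2) log P - 1/4) + σ(S²) m₅ Φ(v)`,
`m₅ = ∫ (1 + |w|)⁵ dM` (pointwise `hardSphereKernel_mul_logWeight_collide_le`, the exact frozen-partner
flux integral `lintegral_posPart_mul_logWeight_eq`, Gaussian moments; same bookkeeping as the tree's
`lintegral_gain_fst_quarticWeight_le`). The leading term is sharp: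
`2 × (π/|v|)(P²/2)(1/2 + log P) / (π|v|) = (P/|v|²)(Φ - P/2)`, i.e. `ν⁻¹ K₂ Φ ≈ Φ - P/2` — the critical
power `P` carries NO margin (`λ₀(2) = 1`), the logarithm buys the absolute margin `P/2`. [folklore] -/
theorem t12_lintegral_gain_fst_logWeight_le : ∀ v : EuclideanSpace ℝ (Fin 3), v ≠ 0 → ∫⁻ w, ∫⁻ ω, ENNReal.ofReal (Literature.MathematicalPhysics.KineticTheory.hardSphereKernel (v, w) ω * Literature.Analysis.FluidPDE.globalMaxwellian w) * ENNReal.ofReal ((1 + ‖(Literature.MathematicalPhysics.KineticTheory.collide ω (v, w)).1‖ ^ 2) * (1 + Real.log (1 + ‖(Literature.MathematicalPhysics.KineticTheory.collide ω (v, w)).1‖ ^ 2))) ∂Literature.MathematicalPhysics.KineticTheory.sphereMeasure ≤ ENNReal.ofReal (Real.pi / ‖v‖ * ((1 + ‖v‖ ^ 2) ^ 2 / 4 + (1 + ‖v‖ ^ 2) ^ 2 / 2 * Real.log (1 + ‖v‖ ^ 2) - 1 / 4) + (Literature.MathematicalPhysics.KineticTheory.sphereMeasure : MeasureTheory.Measure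 (Metric.sphere (0 : EuclideanSpace ℝ (Fin 3)) 1)).real Set.univ * (∫ w, (1 + ‖w‖) ^ 5 ∂ProbabilityTheory.stdGaussian (EuclideanSpace ℝ (Fin 3))) * ((1 + ‖v‖ ^ 2) * (1 + Real.log (1 + ‖v‖ ^ 2)))) := by
  intro v hv
  haveI := isFiniteMeasure_sphereMeasure (E := EuclideanSpace ℝ (Fin 3))
  have hvn : 0 < ‖v‖ := norm_pos_iff.2 hv
  set P : ℝ := 1 + ‖v‖ ^ 2 with hP
  have hP1 : 1 ≤ P := by rw [hP]; nlinarith [norm_nonneg v]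
  set Φ : ℝ := P * (1 + Real.log P) with hΦ
  have hΦ0 : 0 ≤ Φ := mul_nonneg (by linarith) (by linarith [Real.log_nonneg hP1])
  set I : ℝ := Real.pi / ‖v‖ * (P ^ 2 / 4 + P ^ 2 / 2 * Real.log P - 1 / 4) with hI
  have hI0 : 0 ≤ I := by
    have h1 : 0 ≤ P ^ 2 / 4 + P ^ 2 / 2 * Real.log P - 1 / 4 := by nlinarith [Real.log_nonneg hP1, sq_nonneg P]
    rw [hI]; positivity
  set S : ℝ := (sphereMeasure : Measure (sphere (0 : EuclideanSpace ℝ (Fin 3)) 1)).real univ with hS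
  have hS0 : 0 ≤ S := measureReal_nonneg
  have hSuniv : (sphereMeasure : Measure (sphere (0 : EuclideanSpace ℝ (Fin 3)) 1)) univ = ENNReal.ofReal S := by
    rw [hS, measureReal_def, ENNReal.ofReal_toReal (measure_ne_top _ _)]
  set m₅ : ℝ := ∫ w, (1 + ‖w‖) ^ 5 ∂stdGaussian (EuclideanSpace ℝ (Fin 3)) with hm₅
  have hm₅0 : 0 ≤ m₅ := integral_nonneg fun w => by positivity
  -- the two pieces of the pointwise bound
  set F₀ : sphere (0 : EuclideanSpace ℝ (Fin 3)) 1 → ℝ≥0∞ := fun ω =>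
    ENNReal.ofReal (hardSphereKernel (v, 0) ω * ((P - ⟪v, (ω : EuclideanSpace ℝ (Fin 3))⟫_ℝ ^ 2) *
      (1 + Real.log (P - ⟪v, (ω : EuclideanSpace ℝ (Fin 3))⟫_ℝ ^ 2)))) with hF₀
  have hF₀m : Measurable F₀ := by
    have h1 : Measurable fun ω : sphere (0 : EuclideanSpace ℝ (Fin 3)) 1 => hardSphereKernel (v, 0) ω := by
      unfold hardSphereKernel; fun_prop
    have h2 : Measurable fun ω : sphere (0 : EuclideanSpace ℝ (Fin 3)) 1 =>
        P - ⟪v, (ω : EuclideanSpace ℝ (Fin 3))⟫_ℝ ^ 2 := by fun_prop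
    exact (h1.mul (h2.mul (measurable_const.add (Real.measurable_log.comp h2)))).ennreal_ofReal
  have hpt : ∀ w ω, ENNReal.ofReal (hardSphereKernel (v, w) ω * globalMaxwellian w) *
      ENNReal.ofReal ((1 + ‖(collide ω (v, w)).1‖ ^ 2) * (1 + Real.log (1 + ‖(collide ω (v, w)).1‖ ^ 2))) ≤
      ENNReal.ofReal (globalMaxwellian w) * F₀ ω + ENNReal.ofReal (globalMaxwellian w * (1 + ‖w‖) ^ 5) *
        ENNReal.ofReal Φ := by
    intro w ω
    have hM := (globalMaxwellian_pos w).le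
    have hB0 : 0 ≤ hardSphereKernel (v, w) ω := le_max_right _ _
    have hB₀0 : 0 ≤ hardSphereKernel (v, 0) ω := le_max_right _ _
    have h := hardSphereKernel_mul_logWeight_collide_le ω v w
    rw [← hP, ← hΦ] at h
    set Y : ℝ := (1 + ‖(collide ω (v, w)).1‖ ^ 2) * (1 + Real.log (1 + ‖(collide ω (v, w)).1‖ ^ 2))
    set Z : ℝ := (P - ⟪v, (ω : EuclideanSpace ℝ (Fin 3))⟫_ℝ ^ 2) *
      (1 + Real.log (P - ⟪v, (ω : EuclideanSpace ℝ (Fin 3))⟫_ℝ ^ 2))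
    have hZ0 : 0 ≤ Z := by
      have ha2 : ⟪v, (ω : EuclideanSpace ℝ (Fin 3))⟫_ℝ ^ 2 ≤ ‖v‖ ^ 2 := by
        rw [← sq_abs]; exact pow_le_pow_left₀ (abs_nonneg _) (abs_inner_sphere_le v ω) 2
      have h1 : 1 ≤ P - ⟪v, (ω : EuclideanSpace ℝ (Fin 3))⟫_ℝ ^ 2 := by rw [hP]; linarith
      exact mul_nonneg (by linarith) (by linarith [Real.log_nonneg h1])
    by_cases hY0 : Y < 0
    · rw [ENNReal.ofReal_of_nonpos hY0.le, mul_zero]; exact bot_le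
    push Not at hY0
    have key : hardSphereKernel (v, w) ω * globalMaxwellian w * Y ≤
        globalMaxwellian w * (hardSphereKernel (v, 0) ω * Z) + globalMaxwellian w * (1 + ‖w‖) ^ 5 * Φ := by
      have := mul_le_mul_of_nonneg_left h hM
      nlinarith [this]
    calc ENNReal.ofReal (hardSphereKernel (v, w) ω * globalMaxwellian w) * ENNReal.ofReal Y
        = ENNReal.ofReal (hardSphereKernel (v, w) ω * globalMaxwellian w * Y) :=
          (ENNReal.ofReal_mul (mul_nonneg hB0 hM)).symm
      _ ≤ ENNReal.ofReal (globalMaxwellian w * (hardSphereKernel (v, 0) ω * Z) +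
          globalMaxwellian w * (1 + ‖w‖) ^ 5 * Φ) := ENNReal.ofReal_le_ofReal key
      _ = ENNReal.ofReal (globalMaxwellian w) * F₀ ω +
          ENNReal.ofReal (globalMaxwellian w * (1 + ‖w‖) ^ 5) * ENNReal.ofReal Φ := by
          have hM5 : 0 ≤ globalMaxwellian w * (1 + ‖w‖) ^ 5 := mul_nonneg hM (pow_nonneg (by positivity) 5)
          rw [ENNReal.ofReal_add (mul_nonneg hM (mul_nonneg hB₀0 hZ0)) (mul_nonneg hM5 hΦ0),
            @ENNReal.ofReal_mul (globalMaxwellian w) (hardSphereKernel (v, 0) ω * Z) hM,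
            @ENNReal.ofReal_mul (globalMaxwellian w * (1 + ‖w‖) ^ 5) Φ hM5]
  -- integrate in `ω`
  have hω : ∀ w : EuclideanSpace ℝ (Fin 3), ∫⁻ ω, (ENNReal.ofReal (globalMaxwellian w) * F₀ ω +
      ENNReal.ofReal (globalMaxwellian w * (1 + ‖w‖) ^ 5) * ENNReal.ofReal Φ) ∂sphereMeasure =
      ENNReal.ofReal (globalMaxwellian w) * ENNReal.ofReal I +
        ENNReal.ofReal (globalMaxwellian w * (1 + ‖w‖) ^ 5) * ENNReal.ofReal (Φ * S) := by
    intro w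
    rw [lintegral_add_left (hF₀m.const_mul _), lintegral_const_mul _ hF₀m, lintegral_const, hSuniv,
      mul_assoc, ← ENNReal.ofReal_mul hΦ0]
    congr 2
    have h := lintegral_posPart_mul_logWeight_eq hv
    rwa [← hP] at h
  -- integrate in `w`
  have hM1 := lintegral_ofReal_globalMaxwellian_eq_one
  have hM5 := lintegral_ofReal_globalMaxwellian_mul_pow_five
  rw [← hm₅] at hM5
  have hMm : Measurable fun w : EuclideanSpace ℝ (Fin 3) => ENNReal.ofReal (globalMaxwellian w) :=
    continuous_globalMaxwellian.measurable.ennreal_ofReal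
  calc ∫⁻ w, ∫⁻ ω, ENNReal.ofReal (hardSphereKernel (v, w) ω * globalMaxwellian w) *
          ENNReal.ofReal ((1 + ‖(collide ω (v, w)).1‖ ^ 2) * (1 + Real.log (1 + ‖(collide ω (v, w)).1‖ ^ 2))) ∂sphereMeasure
      ≤ ∫⁻ w, ∫⁻ ω, (ENNReal.ofReal (globalMaxwellian w) * F₀ ω +
          ENNReal.ofReal (globalMaxwellian w * (1 + ‖w‖) ^ 5) * ENNReal.ofReal Φ) ∂sphereMeasure :=
        lintegral_mono fun w => lintegral_mono fun ω => hpt w ω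
    _ = ∫⁻ w, (ENNReal.ofReal (globalMaxwellian w) * ENNReal.ofReal I +
          ENNReal.ofReal (globalMaxwellian w * (1 + ‖w‖) ^ 5) * ENNReal.ofReal (Φ * S)) :=
        lintegral_congr hω
    _ = ENNReal.ofReal I + ENNReal.ofReal m₅ * ENNReal.ofReal (Φ * S) := by
        have e1 : ∫⁻ w : EuclideanSpace ℝ (Fin 3), ENNReal.ofReal (globalMaxwellian w) * ENNReal.ofReal I =
            ENNReal.ofReal I := by
          rw [lintegral_mul_const _ hMm, hM1, one_mul]
        have e2 : ∫⁻ w : EuclideanSpace ℝ (Fin 3), ENNReal.ofReal (globalMaxwellian w * (1 + ‖w‖) ^ 5) *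
            ENNReal.ofReal (Φ * S) = ENNReal.ofReal m₅ * ENNReal.ofReal (Φ * S) := by
          rw [lintegral_mul_const' _ _ ENNReal.ofReal_ne_top, hM5]
        have hm1 : Measurable fun w : EuclideanSpace ℝ (Fin 3) => ENNReal.ofReal (globalMaxwellian w) *
            ENNReal.ofReal I := hMm.mul_const _
        rw [lintegral_add_left hm1, e1, e2]
    _ = ENNReal.ofReal (I + S * m₅ * Φ) := by
        rw [← ENNReal.ofReal_mul hm₅0, ← ENNReal.ofReal_add hI0 (mul_nonneg hm₅0 (mul_nonneg hΦ0 hS0))]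
        congr 1
        ring

/-! ### The margin -/

/-- **Registered helper `t12_gain_logWeight_margin` — the log-quadratic weight is a strict
supersolution of the far-field gain operator, with margin `P/4`.** For `v ≠ 0`, `P = 1 + |v|²`,
`Φ = P (1 + log P)`, `m₅ = ∫ (1 + |w|)⁵ dM`: if `(1 + log P)(1/|v|² + 2 σ(S²) m₅/(π|v|)) ≤ 1/4` (true for
`|v| ≥ R₀`, `R₀` absolute, since `log P/|v| → 0`), then twice the gain bound of
`t12_lintegral_gain_fst_logWeight_le` (own piece + partner piece, equal by the exchange symmetry
`K₂'' = K₂'`) is at most `ν(v) (Φ(v) - P/4)`, using only the sharp lower bound `ν(v) ≥ π|v|`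
(`pi_mul_norm_le_collisionFrequency`): `ν⁻¹ K₂ Φ ≤ Φ - P/4`. Algebra: `2 I = (π/(2|v|)) P² (2L - 1) - π/(2|v|)`,
`P² = P (1 + |v|²)`, so `2I = π|v| P L - π|v| P/2 + (π P/(2|v|))(2L - 1) - …`, and the hypothesis is
exactly `π P L/|v| + 2 σ m₅ P L ≤ π |v| P/4`. [folklore] -/
theorem t12_gain_logWeight_margin : ∀ v : EuclideanSpace ℝ (Fin 3), v ≠ 0 → (1 + Real.log (1 + ‖v‖ ^ 2)) * (1 / ‖v‖ ^ 2 + 2 * ((Literature.MathematicalPhysics.KineticTheory.sphereMeasure : MeasureTheory.Measure (Metric.sphere (0 : EuclideanSpace ℝ (Fin 3)) 1)).real Set.univ * ∫ w, (1 + ‖w‖) ^ 5 ∂ProbabilityTheory.stdGaussian (EuclideanSpace ℝ (Fin 3))) / (Real.pi * ‖v‖)) ≤ 1 / 4 → 2 * (Real.pi / ‖v‖ * ((1 + ‖v‖ ^ 2) ^ 2 / 4 + (1 + ‖v‖ ^ 2) ^ 2 / 2 * Real.log (1 + ‖v‖ ^ 2) - 1 / 4) + (Literature.MathematicalPhysics.KineticTheory.sphereMeasure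 : MeasureTheory.Measure (Metric.sphere (0 : EuclideanSpace ℝ (Fin 3)) 1)).real Set.univ * (∫ w, (1 + ‖w‖) ^ 5 ∂ProbabilityTheory.stdGaussian (EuclideanSpace ℝ (Fin 3))) * ((1 + ‖v‖ ^ 2) * (1 + Real.log (1 + ‖v‖ ^ 2)))) ≤ Literature.Analysis.UnboundedOperators.collisionFrequency v * ((1 + ‖v‖ ^ 2) * (1 + Real.log (1 + ‖v‖ ^ 2)) - (1 + ‖v‖ ^ 2) / 4) := by
  intro v hv hfar
  have hs : 0 < ‖v‖ := norm_pos_iff.2 hv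
  set s : ℝ := ‖v‖ with hsdef
  set K : ℝ := (sphereMeasure : Measure (sphere (0 : EuclideanSpace ℝ (Fin 3)) 1)).real univ *
    ∫ w, (1 + ‖w‖) ^ 5 ∂stdGaussian (EuclideanSpace ℝ (Fin 3)) with hK
  have hK0 : 0 ≤ K := mul_nonneg measureReal_nonneg (integral_nonneg fun w => by positivity)
  set P : ℝ := 1 + s ^ 2 with hP
  have hP1 : 1 ≤ P := by rw [hP]; nlinarith
  set L : ℝ := 1 + Real.log P with hL
  have hL1 : 1 ≤ L := by rw [hL]; linarith [Real.log_nonneg hP1]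
  have hπ := Real.pi_pos
  -- the far-field hypothesis, cleared of denominators: `π L + 2 K L s ≤ π s²/4`
  have key : Real.pi * L + 2 * K * L * s ≤ Real.pi * s ^ 2 / 4 := by
    have e : 1 / s ^ 2 + 2 * K / (Real.pi * s) = (Real.pi + 2 * K * s) / (Real.pi * s ^ 2) := by
      field_simp
    rw [e, ← mul_div_assoc, div_le_iff₀ (by positivity)] at hfar
    nlinarith [hfar]
  -- `ν ≥ π s` and the weight margin is nonnegative
  have hν : Real.pi * s ≤ collisionFrequency v := pi_mul_norm_le_collisionFrequency v
  have hm0 : 0 ≤ P * L - P / 4 := by nlinarith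
  refine le_trans ?_ (mul_le_mul_of_nonneg_right hν hm0)
  have e : 2 * (Real.pi / s * (P ^ 2 / 4 + P ^ 2 / 2 * Real.log P - 1 / 4) + K * (P * L)) =
      (Real.pi * P ^ 2 * L - Real.pi * P ^ 2 / 2 - Real.pi / 2 + 2 * K * P * L * s) / s := by
    rw [hL]; field_simp; ring
  rw [e, div_le_iff₀ hs]
  have keyP : Real.pi * P * L + 2 * K * P * L * s ≤ Real.pi * P * s ^ 2 / 4 := by
    have := mul_le_mul_of_nonneg_left key (by linarith : (0:ℝ) ≤ P)
    nlinarith [this]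
  have e2 : Real.pi * P ^ 2 * L - Real.pi * P ^ 2 / 2 =
      Real.pi * P * L - Real.pi * P / 2 + Real.pi * P * s ^ 2 * L - Real.pi * P * s ^ 2 / 2 := by
    rw [hP]; ring
  have e3 : Real.pi * s * (P * L - P / 4) * s = Real.pi * P * s ^ 2 * L - Real.pi * P * s ^ 2 / 4 := by ring
  rw [e3]
  nlinarith [e2, keyP, mul_nonneg hπ.le (by linarith : (0:ℝ) ≤ P)]

end Summit.AtomisticToContinuum.HydrodynamicLimit.Theorems.ClampedCorrectorBirth

end
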